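import Mathlib
import Literature.Analysis.SpecialFunctions.SelbergAomotoCalculus
import Summits.AtomisticToContinuum.BoseEinsteinCondensation.Theorems.BECCellInformationTwoScaleReductionLSI1D

/-!
# Route `BECCellInformation` — support item `TwoScaleReduction` (stmt-AtomisticToContinuum-13443):
# tensorisation step of the defective logarithmic Sobolev inequality on boxes

Helper file (`--supports stmt-AtomisticToContinuum-13443`). For `ε > 0`, `s > 0`, a `C¹`
function `g : ℝ^{d+1} → ℝ` and the box `B = [a, a + s]^{d+1}`, with `f = g² + ε`, `A = ∫_B f`:

  `∫_B f log f ≤ A log (A / s^{d+1}) + (d + 1) A + s² ∫_B |∇g|²`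

GIVEN the same statement in dimension `d` for all `C¹` functions and boxes (`lsi_box_succ`, the
induction step; the induction itself, the limit `ε → 0` and the transport to `EuclideanSpace`
are in the companion file `…LSIBox.lean`). This is the classical tensorisation of (defective)
logarithmic Sobolev inequalities [Gross 1975; Ledoux, *Concentration of measure*, Ch. 5]:
split `x = (t, y)`; the entropy chain rule and the sub-additivity of entropy
`Ent(marginal) ≤ ∫ Ent(fibres)` (here the pointwise convexity inequality
`mul_log_add_mul_log_le`, integrated over the product — no conditional densities are
differentiated) reduce the `(d+1)`-dimensional entropy to the one-dimensional inequality
`lsi_dim_one` on the `t`-fibres and the `d`-dimensional one on the `y`-fibres; `ε > 0` keeps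
every marginal bounded below, so all logarithms are of positive continuous functions and every
integrand is continuous on a compact set.

Also: the transport lemma `setIntegral_box_succ` (`[a,a+s]^{d+1} ≅ [a₀,a₀+s] × [a',a'+s]^d`,
`MeasurableEquiv.piFinSuccAbove`, via `Selberg.piFinSuccAbove_symm_apply_eq_cons` of the tree), fibre calculus (`hasDerivAt_finCons_left`,
`fderiv_finCons_right_apply_single`).
-/

noncomputable section

namespace Summit.AtomisticToContinuum.BoseEinsteinCondensation.Theorems

open MeasureTheory Set
open scoped ENNReal NNReal Topology

namespace TwoScaleReduction

/-! ### Transport: splitting off the first coordinate of a box -/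

/-- **Splitting off the first coordinate of a box integral**:
`∫_{[a, a+s]^{d+1}} Φ = ∫ Φ(t :: y) d(dt|_{[a₀,a₀+s]} ⊗ dy|_{[a', a'+s]^d})`. [folklore] -/
theorem setIntegral_box_succ {d : ℕ} (a : Fin (d + 1) → ℝ) (s : ℝ) (Φ : (Fin (d + 1) → ℝ) → ℝ) :
    ∫ x in Icc a (fun j => a j + s), Φ x =
      ∫ z, Φ (Fin.cons z.1 z.2) ∂((volume.restrict (Icc (a 0) (a 0 + s))).prod
        (volume.restrict (Icc (fun j : Fin d => a j.succ) (fun j => a j.succ + s)))) := by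
  set e := MeasurableEquiv.piFinSuccAbove (fun _ : Fin (d + 1) => ℝ) 0 with he_def
  have hmp : MeasurePreserving e.symm (volume.prod volume) volume :=
    (volume_preserving_piFinSuccAbove (fun _ : Fin (d + 1) => ℝ) 0).symm
  have he : ∀ z : ℝ × (Fin d → ℝ), e.symm z = Fin.cons z.1 z.2 :=
    Literature.Analysis.SpecialFunctions.Selberg.piFinSuccAbove_symm_apply_eq_cons
  have hpre : e.symm ⁻¹' (Icc a (fun j => a j + s)) =
      Icc (a 0) (a 0 + s) ×ˢ Icc (fun j : Fin d => a j.succ) (fun j => a j.succ + s) := by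
    ext ⟨t, y⟩
    simp only [Set.mem_preimage, he, Set.mem_Icc, Set.mem_prod, Pi.le_def, Fin.forall_fin_succ,
      Fin.cons_zero, Fin.cons_succ]
    tauto
  rw [Measure.prod_restrict, ← hpre, ← hmp.setIntegral_preimage_emb e.symm.measurableEmbedding Φ]
  simp only [he]

/-- The volume of the box `[a, a+s]^d` is `s^d`. [folklore] -/
theorem volume_real_box {d : ℕ} (a : Fin d → ℝ) {s : ℝ} (hs : 0 ≤ s) :
    volume.real (Icc a (fun j => a j + s)) = s ^ d := by
  rw [measureReal_def, Real.volume_Icc_pi_toReal fun j => by simp [hs]]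
  simp

/-- Continuous functions are integrable on the box (compactness). [folklore] -/
theorem integrableOn_box {d : ℕ} {Φ : (Fin d → ℝ) → ℝ} (hΦ : Continuous Φ) (a : Fin d → ℝ)
    (s : ℝ) : IntegrableOn Φ (Icc a (fun j => a j + s)) volume :=
  hΦ.continuousOn.integrableOn_compact isCompact_Icc

/-- Continuous functions on `ℝ × ℝ^d` are integrable for the product of the restricted
measures of an interval and a box. [folklore] -/
theorem integrable_prod_box {d : ℕ} {Φ : ℝ × (Fin d → ℝ) → ℝ} (hΦ : Continuous Φ) (a₀ s : ℝ)
    (b : Fin d → ℝ) :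
    Integrable Φ ((volume.restrict (Icc a₀ (a₀ + s))).prod
      (volume.restrict (Icc b (fun j => b j + s)))) := by
  rw [Measure.prod_restrict]
  exact hΦ.continuousOn.integrableOn_compact (isCompact_Icc.prod isCompact_Icc)

/-! ### Calculus of fibres -/

/-- Directional derivative along a coordinate as a one-dimensional derivative:
`τ ↦ φ(update x i τ)` has derivative `Dφ(x)[eᵢ]` at `τ = xᵢ`. [folklore] -/
theorem hasDerivAt_update_comp {m : ℕ} {φ : (Fin m → ℝ) → ℝ} {x : Fin m → ℝ}
    (hφ : DifferentiableAt ℝ φ x) (i : Fin m) :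
    HasDerivAt (fun τ => φ (Function.update x i τ)) (fderiv ℝ φ x (Pi.single i 1)) (x i) :=
  hφ.hasFDerivAt.comp_hasDerivAt_of_eq (x i) (hasDerivAt_update x i (x i)) (by simp)

/-- The `t`-fibre `t ↦ g(t :: y)` has derivative `Dg(t :: y)[e₀]`. [folklore] -/
theorem hasDerivAt_finCons_left {d : ℕ} {g : (Fin (d + 1) → ℝ) → ℝ} (hg : Differentiable ℝ g)
    (y : Fin d → ℝ) (t : ℝ) :
    HasDerivAt (fun τ => g (Fin.cons τ y)) (fderiv ℝ g (Fin.cons t y) (Pi.single 0 1)) t := by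
  have h := hasDerivAt_update_comp (hg (Fin.cons t y)) 0
  simp only [Fin.update_cons_zero, Fin.cons_zero] at h
  exact h

/-- `y ↦ t :: y` is smooth. [folklore] -/
theorem contDiff_finCons_right {d : ℕ} {k : WithTop ℕ∞} (t : ℝ) :
    ContDiff ℝ k fun y : Fin d → ℝ => (Fin.cons t y : Fin (d + 1) → ℝ) := by
  refine contDiff_pi.2 fun i => Fin.cases ?_ (fun j => ?_) i
  · simp only [Fin.cons_zero]; exact contDiff_const
  · simp only [Fin.cons_succ]; exact contDiff_apply ℝ ℝ j

/-- Partial derivatives of the `y`-fibre `y ↦ g(t :: y)`: its `j`-th partial is the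
`(j+1)`-st partial of `g`. [folklore] -/
theorem fderiv_finCons_right_apply_single {d : ℕ} {g : (Fin (d + 1) → ℝ) → ℝ}
    (hg : Differentiable ℝ g) (t : ℝ) (y : Fin d → ℝ) (j : Fin d) :
    fderiv ℝ (fun y' : Fin d → ℝ => g (Fin.cons t y')) y (Pi.single j 1) =
      fderiv ℝ g (Fin.cons t y) (Pi.single j.succ 1) := by
  have hφ : Differentiable ℝ fun y' : Fin d → ℝ => g (Fin.cons t y') :=
    hg.comp (contDiff_finCons_right (k := 1) t).differentiable_one
  have h1 := hasDerivAt_update_comp (hφ y) j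
  have h2 := hasDerivAt_update_comp (hg (Fin.cons t y)) j.succ
  simp only [Fin.cons_succ] at h2
  have hfun : (fun τ => g (Fin.cons t (Function.update y j τ))) =
      fun τ => g (Function.update (Fin.cons t y : Fin (d + 1) → ℝ) j.succ τ) := by
    funext τ; rw [Fin.cons_update]
  rw [hfun] at h1
  exact h1.unique h2

/-! ### The pointwise convexity inequality behind entropy sub-additivity -/

/-- For positive reals: `F log r + F log n ≤ F log F + F log A + n r / A - F`
(`log u ≤ u - 1` at `u = n r / (F A)`). [folklore] -/
theorem mul_log_add_mul_log_le {F r n A : ℝ} (hF : 0 < F) (hr : 0 < r) (hn : 0 < n)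
    (hA : 0 < A) :
    F * Real.log r + F * Real.log n ≤
      F * Real.log F + F * Real.log A + n * r / A - F := by
  have hu : 0 < n * r / (F * A) := by positivity
  have h := Real.log_le_sub_one_of_pos hu
  rw [Real.log_div (by positivity) (by positivity), Real.log_mul hn.ne' hr.ne',
    Real.log_mul hF.ne' hA.ne'] at h
  have h2 := mul_le_mul_of_nonneg_left h hF.le
  have e : F * (n * r / (F * A) - 1) = n * r / A - F := by field_simp
  rw [e] at h2
  nlinarith [h2]


/-! ### The induction step -/

/-- **Induction step of the defective LSI on boxes** (`d → d + 1`): tensorisation of the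
one-dimensional inequality (`lsi_dim_one`) with the `d`-dimensional one (hypothesis `IH`)
through the exact entropy chain rule and the sub-additivity of entropy (pointwise
`mul_log_add_mul_log_le` integrated over the product). [folklore] -/
theorem lsi_box_succ {d : ℕ} {s ε : ℝ} (hs : 0 < s) (hε : 0 < ε)
    (IH : ∀ (h : (Fin d → ℝ) → ℝ), ContDiff ℝ 1 h → ∀ b : Fin d → ℝ,
      ∫ y in Icc b (fun j => b j + s), (h y ^ 2 + ε) * Real.log (h y ^ 2 + ε) ≤
        (∫ y in Icc b (fun j => b j + s), (h y ^ 2 + ε)) *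
            Real.log ((∫ y in Icc b (fun j => b j + s), (h y ^ 2 + ε)) / s ^ d) +
          d * (∫ y in Icc b (fun j => b j + s), (h y ^ 2 + ε)) +
          s ^ 2 * ∫ y in Icc b (fun j => b j + s), ∑ i, (fderiv ℝ h y (Pi.single i 1)) ^ 2)
    (g : (Fin (d + 1) → ℝ) → ℝ) (hg : ContDiff ℝ 1 g) (a : Fin (d + 1) → ℝ) :
    ∫ x in Icc a (fun j => a j + s), (g x ^ 2 + ε) * Real.log (g x ^ 2 + ε) ≤
      (∫ x in Icc a (fun j => a j + s), (g x ^ 2 + ε)) *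
          Real.log ((∫ x in Icc a (fun j => a j + s), (g x ^ 2 + ε)) / s ^ (d + 1)) +
        ((d + 1 : ℕ) : ℝ) * (∫ x in Icc a (fun j => a j + s), (g x ^ 2 + ε)) +
        s ^ 2 * ∫ x in Icc a (fun j => a j + s), ∑ i, (fderiv ℝ g x (Pi.single i 1)) ^ 2 := by
  /- notation: the two factors, their restricted Lebesgue measures, the integrands -/
  set b : Fin d → ℝ := fun j => a j.succ with hb
  set μ : Measure ℝ := volume.restrict (Icc (a 0) (a 0 + s)) with hμ
  set ν : Measure (Fin d → ℝ) := volume.restrict (Icc b (fun j => b j + s)) with hν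
  set F : ℝ × (Fin d → ℝ) → ℝ := fun z => g (Fin.cons z.1 z.2) ^ 2 + ε with hF
  set D0 : ℝ × (Fin d → ℝ) → ℝ := fun z =>
    (fderiv ℝ g (Fin.cons z.1 z.2) (Pi.single 0 1)) ^ 2 with hD0
  set DY : ℝ × (Fin d → ℝ) → ℝ := fun z =>
    ∑ j : Fin d, (fderiv ℝ g (Fin.cons z.1 z.2) (Pi.single j.succ 1)) ^ 2 with hDY
  set n : ℝ → ℝ := fun t => ∫ y, F (t, y) ∂ν with hn
  set r : (Fin d → ℝ) → ℝ := fun y => ∫ t, F (t, y) ∂μ with hr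
  set A : ℝ := ∫ z, F z ∂(μ.prod ν) with hA
  have hgd : Differentiable ℝ g := hg.differentiable_one
  /- finiteness of the measures -/
  haveI hμfin : IsFiniteMeasure μ :=
    ⟨by simp only [hμ, Measure.restrict_apply_univ]; exact isCompact_Icc.measure_lt_top⟩
  haveI hνfin : IsFiniteMeasure ν :=
    ⟨by simp only [hν, Measure.restrict_apply_univ]; exact isCompact_Icc.measure_lt_top⟩
  have hμuniv : μ.real univ = s := by
    rw [hμ, measureReal_restrict_apply_univ, measureReal_def, Real.volume_Icc,
      ENNReal.toReal_ofReal (by linarith)]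
    ring
  have hνuniv : ν.real univ = s ^ d := by
    rw [hν, measureReal_restrict_apply_univ, volume_real_box b hs.le]
  /- continuity -/
  have hcons : Continuous fun z : ℝ × (Fin d → ℝ) => (Fin.cons z.1 z.2 : Fin (d + 1) → ℝ) :=
    Continuous.finCons (A := fun _ : Fin (d + 1) => ℝ) continuous_fst continuous_snd
  have hgc : Continuous g := hg.continuous
  have hFc : Continuous F := by rw [hF]; fun_prop
  have hDc : ∀ i : Fin (d + 1),
      Continuous fun z : ℝ × (Fin d → ℝ) => fderiv ℝ g (Fin.cons z.1 z.2) (Pi.single i 1) :=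
    fun i => ((hg.continuous_fderiv one_ne_zero).comp hcons).clm_apply continuous_const
  have hD0c : Continuous D0 := (hDc 0).pow 2
  have hDYc : Continuous DY := continuous_finsetSum _ fun j _ => (hDc j.succ).pow 2
  have hnc : Continuous n :=
    continuous_parametric_integral_of_continuous (μ := volume) (f := fun t y => F (t, y)) hFc
      (isCompact_Icc (a := b) (b := fun j => b j + s))
  have hrc : Continuous r :=
    continuous_parametric_integral_of_continuous (μ := volume) (f := fun y t => F (t, y))
      (hFc.comp continuous_swap) (isCompact_Icc (a := a 0) (b := a 0 + s))
  /- integrability on the product and on the factors -/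
  have iprod : ∀ {Φ : ℝ × (Fin d → ℝ) → ℝ}, Continuous Φ → Integrable Φ (μ.prod ν) :=
    fun hΦ => integrable_prod_box hΦ (a 0) s b
  have iμ : ∀ {φ : ℝ → ℝ}, Continuous φ → Integrable φ μ := fun hφ =>
    hφ.continuousOn.integrableOn_compact isCompact_Icc
  have iν : ∀ {φ : (Fin d → ℝ) → ℝ}, Continuous φ → Integrable φ ν := fun hφ =>
    hφ.continuousOn.integrableOn_compact isCompact_Icc
  have iF : Integrable F (μ.prod ν) := iprod hFc
  /- positivity -/
  have hF_ge : ∀ z, ε ≤ F z := fun z => by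
    simp only [hF]; nlinarith [sq_nonneg (g (Fin.cons z.1 z.2))]
  have hF_pos : ∀ z, 0 < F z := fun z => hε.trans_le (hF_ge z)
  have hn_ge : ∀ t, ε * s ^ d ≤ n t := by
    intro t
    have h := integral_mono (integrable_const ε) (iν (hFc.comp (Continuous.prodMk_right t)))
      fun y => hF_ge (t, y)
    rwa [integral_const, smul_eq_mul, hνuniv, mul_comm] at h
  have hn_pos : ∀ t, 0 < n t := fun t => (by positivity : 0 < ε * s ^ d).trans_le (hn_ge t)
  have hr_ge : ∀ y, ε * s ≤ r y := by
    intro y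
    have h := integral_mono (integrable_const ε) (iμ (hFc.comp (Continuous.prodMk_left y)))
      fun t => hF_ge (t, y)
    rwa [integral_const, smul_eq_mul, hμuniv, mul_comm] at h
  have hr_pos : ∀ y, 0 < r y := fun y => (by positivity : 0 < ε * s).trans_le (hr_ge y)
  /- Fubini for the mass -/
  have hA_t : A = ∫ t, n t ∂μ := integral_prod F iF
  have hA_y : A = ∫ y, r y ∂ν := integral_prod_symm F iF
  have hA_pos : 0 < A := by
    have h := integral_mono (integrable_const (ε * s ^ d)) (iμ hnc) hn_ge
    rw [integral_const, smul_eq_mul, hμuniv, ← hA_t] at h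
    exact (by positivity : 0 < s * (ε * s ^ d)).trans_le h
  /- the logarithms of the (positive, continuous) marginals are continuous -/
  have hlogr_c : Continuous fun y => Real.log (r y) :=
    Real.continuousOn_log.comp_continuous hrc fun y => (hr_pos y).ne'
  have hlogn_c : Continuous fun t => Real.log (n t) :=
    Real.continuousOn_log.comp_continuous hnc fun t => (hn_pos t).ne'
  have iFlr : Integrable (fun z : ℝ × (Fin d → ℝ) => F z * Real.log (r z.2)) (μ.prod ν) :=
    iprod (hFc.mul (hlogr_c.comp continuous_snd))
  have iFln : Integrable (fun z : ℝ × (Fin d → ℝ) => F z * Real.log (n z.1)) (μ.prod ν) :=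
    iprod (hFc.mul (hlogn_c.comp continuous_fst))
  have iFlF : Integrable (fun z : ℝ × (Fin d → ℝ) => F z * Real.log (F z)) (μ.prod ν) :=
    iprod (Real.continuous_mul_log.comp hFc)
  have iFlA : Integrable (fun z : ℝ × (Fin d → ℝ) => F z * Real.log A) (μ.prod ν) :=
    iprod (hFc.mul continuous_const)
  have inr : Integrable (fun z : ℝ × (Fin d → ℝ) => n z.1 * r z.2 / A) (μ.prod ν) :=
    iprod (((hnc.comp continuous_fst).mul (hrc.comp continuous_snd)).div_const A)
  have iD0 : Integrable D0 (μ.prod ν) := iprod hD0c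
  have iDY : Integrable DY (μ.prod ν) := iprod hDYc
  /- (LS) entropy sub-additivity: Ent(marginals) ≤ fibrewise entropies -/
  have hLS : (∫ y, r y * Real.log (r y) ∂ν) + ∫ t, n t * Real.log (n t) ∂μ ≤
      (∫ z, F z * Real.log (F z) ∂(μ.prod ν)) + A * Real.log A := by
    have hpw : ∀ z : ℝ × (Fin d → ℝ), F z * Real.log (r z.2) + F z * Real.log (n z.1) ≤
        F z * Real.log (F z) + F z * Real.log A + n z.1 * r z.2 / A - F z := fun z =>
      mul_log_add_mul_log_le (hF_pos z) (hr_pos z.2) (hn_pos z.1) hA_pos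
    have iL : Integrable (fun z : ℝ × (Fin d → ℝ) =>
        F z * Real.log (r z.2) + F z * Real.log (n z.1)) (μ.prod ν) := iFlr.add iFln
    have iFA : Integrable (fun z : ℝ × (Fin d → ℝ) =>
        F z * Real.log (F z) + F z * Real.log A) (μ.prod ν) := iFlF.add iFlA
    have iFAn : Integrable (fun z : ℝ × (Fin d → ℝ) =>
        F z * Real.log (F z) + F z * Real.log A + n z.1 * r z.2 / A) (μ.prod ν) := iFA.add inr
    have iR : Integrable (fun z : ℝ × (Fin d → ℝ) =>
        F z * Real.log (F z) + F z * Real.log A + n z.1 * r z.2 / A - F z) (μ.prod ν) :=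
      iFAn.sub iF
    have hint := integral_mono iL iR hpw
    have e1 : ∫ z, F z * Real.log (r z.2) ∂(μ.prod ν) = ∫ y, r y * Real.log (r y) ∂ν := by
      rw [integral_prod_symm _ iFlr]
      refine integral_congr_ae (Filter.Eventually.of_forall fun y => ?_)
      exact integral_mul_const (Real.log (r y)) fun t => F (t, y)
    have e2 : ∫ z, F z * Real.log (n z.1) ∂(μ.prod ν) = ∫ t, n t * Real.log (n t) ∂μ := by
      rw [integral_prod _ iFln]
      refine integral_congr_ae (Filter.Eventually.of_forall fun t => ?_)
      exact integral_mul_const (Real.log (n t)) fun y => F (t, y)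
    have e3 : ∫ z, F z * Real.log A ∂(μ.prod ν) = A * Real.log A := integral_mul_const _ _
    have e4 : ∫ z, n z.1 * r z.2 / A ∂(μ.prod ν) = A := by
      rw [integral_div, integral_prod_mul (μ := μ) (ν := ν) n r, ← hA_t, ← hA_y]
      field_simp
    rw [integral_add iFlr iFln, integral_sub iFAn iF, integral_add iFA inr, integral_add iFlF iFlA,
      e1, e2, e3, e4] at hint
    linarith
  /- (T1) the one-dimensional inequality on the `t`-fibres, integrated over `y` -/
  have h1D : ∀ y, ∫ t, F (t, y) * Real.log (F (t, y)) ∂μ ≤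
      r y * Real.log (r y / s) + r y + s ^ 2 * ∫ t, D0 (t, y) ∂μ := fun y =>
    lsi_dim_one (g := fun t => g (Fin.cons t y))
      (g' := fun t => fderiv ℝ g (Fin.cons t y) (Pi.single 0 1))
      (fun t => hasDerivAt_finCons_left hgd y t) ((hDc 0).comp (Continuous.prodMk_left y))
      hε.le (a 0) hs
  have hT1 : ∫ z, F z * Real.log (F z) ∂(μ.prod ν) ≤
      (∫ y, r y * Real.log (r y) ∂ν) - A * Real.log s + A + s ^ 2 * ∫ z, D0 z ∂(μ.prod ν) := by
    have hrls_c : Continuous fun y => r y * Real.log (r y / s) :=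
      hrc.mul (Real.continuousOn_log.comp_continuous (hrc.div_const s)
        fun y => (div_pos (hr_pos y) hs).ne')
    have i1 : Integrable (fun y => r y * Real.log (r y / s)) ν := iν hrls_c
    have i2 : Integrable r ν := iν hrc
    have i3 : Integrable (fun y => ∫ t, D0 (t, y) ∂μ) ν := iD0.integral_prod_right
    have i12 : Integrable (fun y => r y * Real.log (r y / s) + r y) ν := i1.add i2
    have i123 : Integrable (fun y => r y * Real.log (r y / s) + r y + s ^ 2 * ∫ t, D0 (t, y) ∂μ) ν :=
      i12.add (i3.const_mul _)
    have step := integral_mono iFlF.integral_prod_right i123 h1D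
    rw [integral_add i12 (i3.const_mul _), integral_add i1 i2, integral_const_mul,
      ← integral_prod_symm _ iFlF, ← integral_prod_symm _ iD0, ← hA_y] at step
    have e5 : ∫ y, r y * Real.log (r y / s) ∂ν = (∫ y, r y * Real.log (r y) ∂ν) - A * Real.log s := by
      have h' : ∀ y, r y * Real.log (r y / s) = r y * Real.log (r y) - r y * Real.log s :=
        fun y => by rw [Real.log_div (hr_pos y).ne' hs.ne']; ring
      simp_rw [h']
      have irlr : Integrable (fun y => r y * Real.log (r y)) ν := iν (hrc.mul hlogr_c)
      have irls : Integrable (fun y => r y * Real.log s) ν := i2.mul_const _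
      rw [integral_sub irlr irls, integral_mul_const, ← hA_y]
    linarith
  /- (N) entropy of the `t`-marginal -/
  have hN : ∫ t, n t * Real.log (n t) ∂μ ≤
      A * Real.log A - A * Real.log s + A + s ^ 2 * ∫ z, D0 z ∂(μ.prod ν) := by linarith
  /- (T2) the induction hypothesis on the `y`-fibres, integrated over `t` -/
  have hIHt : ∀ t, ∫ y, F (t, y) * Real.log (F (t, y)) ∂ν ≤
      n t * Real.log (n t / s ^ d) + d * n t + s ^ 2 * ∫ y, DY (t, y) ∂ν := by
    intro t
    have hct : ContDiff ℝ 1 fun y : Fin d → ℝ => g (Fin.cons t y) :=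
      hg.comp (contDiff_finCons_right t)
    have h := IH _ hct b
    have hDYeq : ∀ y : Fin d → ℝ,
        (∑ i, (fderiv ℝ (fun y' : Fin d → ℝ => g (Fin.cons t y')) y (Pi.single i 1)) ^ 2) =
          DY (t, y) := fun y => by
      simp only [hDY, fderiv_finCons_right_apply_single hgd]
    simp_rw [hDYeq] at h
    exact h
  have hT2 : ∫ z, F z * Real.log (F z) ∂(μ.prod ν) ≤
      (∫ t, n t * Real.log (n t) ∂μ) - d * A * Real.log s + d * A +
        s ^ 2 * ∫ z, DY z ∂(μ.prod ν) := by
    have hnls_c : Continuous fun t => n t * Real.log (n t / s ^ d) :=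
      hnc.mul (Real.continuousOn_log.comp_continuous (hnc.div_const _)
        fun t => (div_pos (hn_pos t) (pow_pos hs d)).ne')
    have i1 : Integrable (fun t => n t * Real.log (n t / s ^ d)) μ := iμ hnls_c
    have i2 : Integrable (fun t => (d : ℝ) * n t) μ := (iμ hnc).const_mul _
    have i3 : Integrable (fun t => ∫ y, DY (t, y) ∂ν) μ := iDY.integral_prod_left
    have i12 : Integrable (fun t => n t * Real.log (n t / s ^ d) + (d : ℝ) * n t) μ := i1.add i2
    have i123 : Integrable (fun t => n t * Real.log (n t / s ^ d) + (d : ℝ) * n t +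
        s ^ 2 * ∫ y, DY (t, y) ∂ν) μ := i12.add (i3.const_mul _)
    have step := integral_mono iFlF.integral_prod_left i123 hIHt
    rw [integral_add i12 (i3.const_mul _), integral_add i1 i2, integral_const_mul,
      integral_const_mul, ← integral_prod _ iFlF, ← integral_prod _ iDY, ← hA_t] at step
    have e6 : ∫ t, n t * Real.log (n t / s ^ d) ∂μ =
        (∫ t, n t * Real.log (n t) ∂μ) - d * A * Real.log s := by
      have h' : ∀ t, n t * Real.log (n t / s ^ d) = n t * Real.log (n t) - d * Real.log s * n t :=
        fun t => by rw [Real.log_div (hn_pos t).ne' (pow_ne_zero _ hs.ne'), Real.log_pow]; ring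
      simp_rw [h']
      have inln : Integrable (fun t => n t * Real.log (n t)) μ := iμ (hnc.mul hlogn_c)
      have idn : Integrable (fun t => (d : ℝ) * Real.log s * n t) μ := (iμ hnc).const_mul _
      rw [integral_sub inln idn, integral_const_mul, ← hA_t]
      ring
    linarith
  /- combine and transport back to the box -/
  have hmain : ∫ z, F z * Real.log (F z) ∂(μ.prod ν) ≤
      A * Real.log A - (d + 1) * A * Real.log s + (d + 1) * A +
        s ^ 2 * ((∫ z, D0 z ∂(μ.prod ν)) + ∫ z, DY z ∂(μ.prod ν)) := by nlinarith [hT2, hN]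
  have t1 : ∫ x in Icc a (fun j => a j + s), (g x ^ 2 + ε) * Real.log (g x ^ 2 + ε) =
      ∫ z, F z * Real.log (F z) ∂(μ.prod ν) :=
    setIntegral_box_succ a s fun x => (g x ^ 2 + ε) * Real.log (g x ^ 2 + ε)
  have t2 : ∫ x in Icc a (fun j => a j + s), (g x ^ 2 + ε) = A :=
    setIntegral_box_succ a s fun x => g x ^ 2 + ε
  have t3 : ∫ x in Icc a (fun j => a j + s), ∑ i, (fderiv ℝ g x (Pi.single i 1)) ^ 2 =
      (∫ z, D0 z ∂(μ.prod ν)) + ∫ z, DY z ∂(μ.prod ν) := by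
    rw [setIntegral_box_succ, ← integral_add iD0 iDY]
    refine integral_congr_ae (Filter.Eventually.of_forall fun z => ?_)
    simp only [hD0, hDY, Fin.sum_univ_succ]
  have elog : A * Real.log (A / s ^ (d + 1)) = A * Real.log A - (d + 1) * A * Real.log s := by
    rw [Real.log_div hA_pos.ne' (pow_ne_zero _ hs.ne'), Real.log_pow]; push_cast; ring
  rw [t1, t2, t3, elog]
  push_cast
  linarith

end TwoScaleReduction

end Summit.AtomisticToContinuum.BoseEinsteinCondensation.Theorems
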